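import Summits.CriticalPhenomena.CardyFormulaZ2.Theorems.CardyIKTransportCornerLineDescentFreezeContinuity
import Literature.Probability.Percolation.QuadCrossingContinuityOfBound
import Literature.Probability.Percolation.QuadCrossingSquareModel
import Literature.Probability.Percolation.OpenPathAnnulusCrossing
import Literature.Probability.Percolation.AnnulusSubcontinuum
import Literature.Probability.Percolation.IsoradialPathCrossing
import Literature.Probability.Percolation.PlanarDuality
import Literature.Probability.LatticeModels.IsoradialReflection

/-!
# The frozen end's continuity statement from Schramm–Smirnov (5.1), I: chart quads and the upper inclusion

Support file (part 1 of 3 of a BRIDGE) for the registered stub `stub_CrudeCrossingContinuity` of the line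
`symmetric-seed-second-order` of the crux `CardyIKTransport.CornerLineDescent` (stmt-CriticalPhenomena-10964): the
stub is `∀ R, Freeze.CrudeCrossingContinuity R` (`Theorems/CardyIKTransportCornerLineDescentFreezeContinuity.lean`),
the mesh-uniform insensitivity of crude bond-`ℤ²` crossing probabilities of a conformal rectangle to the
discretisation of the domain.  The bridge (`…CrudeContinuity.lean`) derives it from the tree's named fact
`SchrammSmirnov2011_lemma_5_1` (O. Schramm, S. Smirnov, Ann. Probab. 39 (2011), Lemma 5.1; undischarged) through the
proved converse `QuadCrossing.Quad.continuity_of_lemma_5_1` (Lemma 5.1 ⇒ the discrete estimate (5.1): for every quad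
`Q₀` of the plane and `ε > 0` there are `Q' < Q₀ < Q''` and `δ₀ > 0` with
`P_{1/2}[Q' crossed inside the open edges of δℤ² ∧ Q'' not] ≤ ε` for `δ < δ₀`).  What has to be supplied is the
dictionary between Schramm–Smirnov's PARAMETRISED quads with their continuum crossings inside `openEdgeUnion`, and the
vocabulary's `openCrossing` events of lattice paths near a Jordan domain:

* `Freeze.tmodel Φ` — the transposed square model `Ψ = Φ ∘ (x + iy ↦ y + ix)` of a square model `Φ` of `R`
  (`exists_isSquareModel`, Schoenflies): `Ψ([-1,1]²) = closure Ω`, `Ψ((-1,1)²) = Ω`, left/right sides onto the arcs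
  `0`/`2`, bottom/top onto the arcs `3`/`1` — so that arc-`0`-to-arc-`2` crossings are read horizontally, as the
  `Quad.side 0 → Quad.side 2` crossings of `QuadCrossingSpace.lean`;
* `Freeze.chartQuad Ψ x₀ x₁ y₀ y₁` — the chart quads `Ψ ∘ rectChart` of the plane (Schramm–Smirnov's `Q^q`), in
  particular the model quad `Ψ([-1,1]²)`, the short fat quad `Freeze.fatQuad Ψ s = Ψ([-1+s,1-s] × [-1-s,1+s])` and
  the long thin quad `Freeze.thinQuad Ψ t s = Ψ([-1-t,1+t] × [-1+s,1-s])`;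
* the upper inclusion `Freeze.exists_upper_gap` (anchor `upperCrossing_subset_fatQuad_crossing`): for small meshes
  and fattening radii, on lattice configurations, the fattened crude event `Freeze.upperCrossing R ρ δ` gives a crossing
  of the short fat quad inside the drawn open edges (a sub-continuum of the polyline of the open walk between the
  levels `re ∘ Ψ⁻¹ = ∓(1-s)`, `exists_subcontinuum_between_levels`).

Part 2 (`…CrudeContinuity3.lean`) is the lower inclusion (crossings of the long thin quad give the thinned
collar-to-collar event), part 3 the assembly.  Everything here is proved; no named fact is introduced.
References: Schramm–Smirnov, Ann. Probab. 39 (2011) §1.3, §5 (proof of Lemma 5.1, the quads `Q^q`); route file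
`Theses/CardyIKTransport.lean` (item 10964).
-/

noncomputable section

namespace Summit.CriticalPhenomena.CardyFormulaZ2.Theorems.CornerLineDescent.SymmetricSeed

open scoped Topology unitInterval ENNReal
open Filter Set Function Metric MeasureTheory
open Literature.Probability.Percolation (IsSquareModel exists_isSquareModel unitSquareQuad unitSquareQuad_carrier
  BondConfig openEdgeUnion mem_openEdgeUnion_iff openCrossing openConnIn bondPercolation half)
open Literature.Probability.Percolation.QuadCrossing (Quad)
open Literature.Probability.Percolation.QuadCrossing.Quad (rectChart rectChart_re_im continuous_rectChart
  rectChart_injective carrier_eq_of_chart side_zero_eq_of_chart side_two_eq_of_chart Dominated StrictlyDominated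
  strictlyDominated_iff)
open Literature.Probability.LatticeModels
open Literature.Probability.RandomPlanarGeometry

namespace Freeze

/-! ## The coordinate swap and the transposed square model -/

/-- The coordinate swap `x + iy ↦ y + ix` of the plane (the tree's `swapXY`, an isometric involution) as a
homeomorphism. [folklore] -/
def swapHomeo : ℂ ≃ₜ ℂ where
  toFun := swapXY
  invFun := swapXY
  left_inv := swapXY_swapXY
  right_inv := swapXY_swapXY
  continuous_toFun := by
    rw [show swapXY = fun w : ℂ => (w.im : ℂ) + (w.re : ℂ) * Complex.I from
      funext fun w => Complex.ext (by simp) (by simp)]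
    fun_prop
  continuous_invFun := by
    rw [show swapXY = fun w : ℂ => (w.im : ℂ) + (w.re : ℂ) * Complex.I from
      funext fun w => Complex.ext (by simp) (by simp)]
    fun_prop

/-- The swap homeomorphism is the tree's `swapXY`. [folklore] -/
@[simp] theorem coe_swapHomeo : ⇑swapHomeo = swapXY := rfl

/-- The swap maps a product set `A × B` onto `B × A`. [folklore] -/
theorem image_swapXY_reProdIm (A B : Set ℝ) : swapXY '' (A ×ℂ B) = B ×ℂ A := by
  ext z
  simp only [mem_image, Complex.mem_reProdIm]
  constructor
  · rintro ⟨w, ⟨h1, h2⟩, rfl⟩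
    rw [swapXY_re, swapXY_im]
    exact ⟨h2, h1⟩
  · rintro ⟨h1, h2⟩
    exact ⟨swapXY z, by rw [swapXY_re, swapXY_im]; exact ⟨h2, h1⟩, swapXY_swapXY z⟩

/-- THE TRANSPOSED SQUARE MODEL `Ψ = Φ ∘ swap` of a square model `Φ`: it maps the LEFT side `{-1} × [-1,1]` of the
square onto `arc 0` and the RIGHT side onto `arc 2`, so that crossings between the arcs `0` and `2` are read
horizontally, as for Schramm–Smirnov's parametrised quads (`Quad.side 0 = Q({0} × [0,1])`). [folklore] -/
def tmodel (Φ : ℂ ≃ₜ ℂ) : ℂ ≃ₜ ℂ := swapHomeo.trans Φ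

/-- The transposed model as a composition. [folklore] -/
theorem coe_tmodel (Φ : ℂ ≃ₜ ℂ) : ⇑(tmodel Φ) = Φ ∘ swapXY := rfl

section Model

variable {R : ConformalRectangle} {Φ : ℂ ≃ₜ ℂ} (hΦ : IsSquareModel R Φ)
include hΦ

/-- The transposed model maps the open square onto the domain. [folklore] -/
theorem tmodel_image_Ioo : tmodel Φ '' (Ioo (-1 : ℝ) 1 ×ℂ Ioo (-1 : ℝ) 1) = R.carrier := by
  rw [coe_tmodel, image_comp, image_swapXY_reProdIm, ← unitSquareQuad_carrier, hΦ.image_carrier]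

/-- The transposed model maps the closed square onto the closed domain. [folklore] -/
theorem tmodel_image_Icc : tmodel Φ '' (Icc (-1 : ℝ) 1 ×ℂ Icc (-1 : ℝ) 1) = closure R.carrier := by
  rw [coe_tmodel, image_comp, image_swapXY_reProdIm, hΦ.image_Icc]

/-- The transposed model maps the left side onto `arc 0`. [folklore] -/
theorem tmodel_image_left : tmodel Φ '' ({(-1 : ℝ)} ×ℂ Icc (-1 : ℝ) 1) = R.arc 0 := by
  rw [coe_tmodel, image_comp, image_swapXY_reProdIm, ← hΦ.image_arc 0]
  congr 1
  ext z
  rw [Literature.Probability.Percolation.SquareModel.mem_arc_zero, Complex.mem_reProdIm, mem_singleton_iff]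
  tauto

/-- The transposed model maps the right side onto `arc 2`. [folklore] -/
theorem tmodel_image_right : tmodel Φ '' ({(1 : ℝ)} ×ℂ Icc (-1 : ℝ) 1) = R.arc 2 := by
  rw [coe_tmodel, image_comp, image_swapXY_reProdIm, ← hΦ.image_arc 2]
  congr 1
  ext z
  rw [Literature.Probability.Percolation.SquareModel.mem_arc_two, Complex.mem_reProdIm, mem_singleton_iff]
  tauto

/-- The transposed model maps the bottom side onto `arc 3`. [folklore] -/
theorem tmodel_image_bot : tmodel Φ '' (Icc (-1 : ℝ) 1 ×ℂ {(-1 : ℝ)}) = R.arc 3 := by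
  rw [coe_tmodel, image_comp, image_swapXY_reProdIm, ← hΦ.image_arc 3]
  congr 1
  ext z
  rw [Literature.Probability.Percolation.SquareModel.mem_arc_three, Complex.mem_reProdIm, mem_singleton_iff]

/-- The transposed model maps the top side onto `arc 1`. [folklore] -/
theorem tmodel_image_top : tmodel Φ '' (Icc (-1 : ℝ) 1 ×ℂ {(1 : ℝ)}) = R.arc 1 := by
  rw [coe_tmodel, image_comp, image_swapXY_reProdIm, ← hΦ.image_arc 1]
  congr 1
  ext z
  rw [Literature.Probability.Percolation.SquareModel.mem_arc_one, Complex.mem_reProdIm, mem_singleton_iff]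

end Model

/-! ## Elementary plane tools -/

/-- Membership in the image of a set under a plane homeomorphism, read through the inverse. [folklore] -/
theorem mem_image_iff_symm_mem (Ψ : ℂ ≃ₜ ℂ) {A : Set ℂ} {z : ℂ} : z ∈ Ψ '' A ↔ Ψ.symm z ∈ A := by
  rw [← Ψ.preimage_symm, mem_preimage]

/-- A COMPACT SET AND A DISJOINT CLOSED SET ARE A POSITIVE DISTANCE APART. [folklore] -/
theorem exists_gap {K L : Set ℂ} (hK : IsCompact K) (hL : IsClosed L) (h : Disjoint K L) :
    ∃ g : ℝ, 0 < g ∧ ∀ k ∈ K, ∀ l ∈ L, g < dist k l := by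
  obtain ⟨g, hg, hsub⟩ := hK.exists_cthickening_subset_open hL.isOpen_compl
    (fun k hk => Set.disjoint_left.1 h hk)
  refine ⟨g, hg, fun k hk l hl => ?_⟩
  by_contra hle
  push Not at hle
  have : l ∈ cthickening g K := Metric.mem_cthickening_of_dist_le l k g K hk (by rwa [dist_comm])
  exact hsub this hl

/-- UNIFORM CONTINUITY OF A PLANE HOMEOMORPHISM ON THE SQUARE `[-2, 2]²`, in `ε`–`θ` form. [folklore] -/
theorem exists_modulus (Ψ : ℂ ≃ₜ ℂ) {r : ℝ} (hr : 0 < r) :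
    ∃ θ : ℝ, 0 < θ ∧ ∀ a ∈ Icc (-2 : ℝ) 2 ×ℂ Icc (-2 : ℝ) 2, ∀ b ∈ Icc (-2 : ℝ) 2 ×ℂ Icc (-2 : ℝ) 2,
      dist a b ≤ θ → dist (Ψ a) (Ψ b) ≤ r := by
  have hCc : IsCompact (Icc (-2 : ℝ) 2 ×ℂ Icc (-2 : ℝ) 2) := isCompact_Icc.reProdIm isCompact_Icc
  obtain ⟨θ, hθ, hΨθ⟩ := Metric.uniformContinuousOn_iff.1
    (hCc.uniformContinuousOn_of_continuous Ψ.continuous.continuousOn) r hr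
  exact ⟨θ / 2, by linarith, fun a ha b hb hab => (hΨθ a ha b hb (by linarith)).le⟩

/-! ## Chart quads of a plane homeomorphism -/

/-- THE CHART QUAD `Ψ ∘ rectChart x₀ x₁ y₀ y₁` OF THE PLANE: the `Ψ`-image of the coordinate rectangle
`[x₀, x₁] × [y₀, y₁]`, parametrised affinely (Schramm–Smirnov's `Q^q`, with `Q̂₀ = Ψ`). [folklore] -/
def chartQuad (Ψ : ℂ ≃ₜ ℂ) (x₀ x₁ y₀ y₁ : ℝ) (hx : x₀ < x₁) (hy : y₀ < y₁) : Quad (univ : Set ℂ) where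
  toFun p := Ψ (rectChart x₀ x₁ y₀ y₁ p)
  continuous_toFun := Ψ.continuous.comp (continuous_rectChart _ _ _ _)
  injective_toFun := Ψ.injective.comp (rectChart_injective hx.ne hy.ne)
  range_subset := fun _ _ => mem_univ _

section Chart

variable (Ψ : ℂ ≃ₜ ℂ) {x₀ x₁ y₀ y₁ : ℝ} (hx : x₀ < x₁) (hy : y₀ < y₁)

/-- The chart quad, evaluated. [folklore] -/
@[simp] theorem chartQuad_apply (p : I × I) : chartQuad Ψ x₀ x₁ y₀ y₁ hx hy p = Ψ (rectChart x₀ x₁ y₀ y₁ p) := rfl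

/-- The carrier of a chart quad. [folklore] -/
theorem carrier_chartQuad : (chartQuad Ψ x₀ x₁ y₀ y₁ hx hy).carrier = Ψ '' (Icc x₀ x₁ ×ℂ Icc y₀ y₁) := by
  rw [carrier_eq_of_chart (Q := chartQuad Ψ x₀ x₁ y₀ y₁ hx hy) (H := Ψ) (fun p => rfl) hx.ne hy.ne,
    uIcc_of_le hx.le, uIcc_of_le hy.le]

/-- Side `0` of a chart quad: the image of the left edge. [folklore] -/
theorem side_zero_chartQuad : (chartQuad Ψ x₀ x₁ y₀ y₁ hx hy).side 0 = Ψ '' ({x₀} ×ℂ Icc y₀ y₁) := by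
  rw [side_zero_eq_of_chart (Q := chartQuad Ψ x₀ x₁ y₀ y₁ hx hy) (H := Ψ) (fun p => rfl) hy.ne, uIcc_of_le hy.le]

/-- Side `2` of a chart quad: the image of the right edge. [folklore] -/
theorem side_two_chartQuad : (chartQuad Ψ x₀ x₁ y₀ y₁ hx hy).side 2 = Ψ '' ({x₁} ×ℂ Icc y₀ y₁) := by
  rw [side_two_eq_of_chart (Q := chartQuad Ψ x₀ x₁ y₀ y₁ hx hy) (H := Ψ) (fun p => rfl) hy.ne, uIcc_of_le hy.le]

end Chart

/-- THE SHORT FAT CHART QUAD `Ψ([-1+s, 1-s] × [-1-s, 1+s])` (for `0 < s < 1`; the model quad `Ψ([-1,1]²)` otherwise):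
shorter in the crossing direction and sticking out across the two other sides. [folklore] -/
def fatQuad (Ψ : ℂ ≃ₜ ℂ) (s : ℝ) : Quad (univ : Set ℂ) :=
  if h : 0 < s ∧ s < 1 then chartQuad Ψ (-1 + s) (1 - s) (-1 - s) (1 + s) (by linarith [h.1, h.2]) (by linarith [h.1])
  else chartQuad Ψ (-1) 1 (-1) 1 (by norm_num) (by norm_num)

/-- The short fat chart quad, unfolded. [folklore] -/
theorem fatQuad_eq (Ψ : ℂ ≃ₜ ℂ) {s : ℝ} (hs : 0 < s) (hs1 : s < 1) :
    fatQuad Ψ s = chartQuad Ψ (-1 + s) (1 - s) (-1 - s) (1 + s) (by linarith) (by linarith) := by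
  rw [fatQuad, dif_pos ⟨hs, hs1⟩]

/-- THE LONG THIN CHART QUAD `Ψ([-1-t, 1+t] × [-1+s, 1-s])` (for `0 < t`, `0 < s < 1`; the model quad otherwise):
sticking out across the two sides to be joined and keeping off the two other sides. [folklore] -/
def thinQuad (Ψ : ℂ ≃ₜ ℂ) (t s : ℝ) : Quad (univ : Set ℂ) :=
  if h : 0 < t ∧ 0 < s ∧ s < 1 then
    chartQuad Ψ (-1 - t) (1 + t) (-1 + s) (1 - s) (by linarith [h.1]) (by linarith [h.2.1, h.2.2])
  else chartQuad Ψ (-1) 1 (-1) 1 (by norm_num) (by norm_num)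

/-- The long thin chart quad, unfolded. [folklore] -/
theorem thinQuad_eq (Ψ : ℂ ≃ₜ ℂ) {t s : ℝ} (ht : 0 < t) (hs : 0 < s) (hs1 : s < 1) :
    thinQuad Ψ t s = chartQuad Ψ (-1 - t) (1 + t) (-1 + s) (1 - s) (by linarith) (by linarith) := by
  rw [thinQuad, dif_pos ⟨ht, hs, hs1⟩]

/-! ## Lattice points and thickenings -/

/-- The drawn lattice point `δ · z(x)` of the vocabulary is the mesh point of mesh `δ√2`. [folklore] -/
theorem smul_z_eq_meshPoint (δ : ℝ) (x : Site 2) :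
    (δ : ℂ) * squareLatticeEmbedding.z x = meshPoint (δ * Real.sqrt 2) x := by
  rw [squareLatticeEmbedding_z, meshPoint, ← mul_assoc]
  push_cast
  ring

/-- A point at `infDist ≤ r` from a nonempty compact set lies in its closed `r`-thickening. [folklore] -/
theorem mem_cthickening_of_infDist_le {E : Set ℂ} (hE : IsCompact E) (hne : E.Nonempty) {x : ℂ} {r : ℝ}
    (h : infDist x E ≤ r) : x ∈ cthickening r E := by
  obtain ⟨y, hy, hxy⟩ := hE.exists_infDist_eq_dist hne x
  exact mem_cthickening_of_dist_le x y r E hy (hxy ▸ h)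

/-! ## The fattened crude event crosses the short fat chart quad -/

section Upper

variable {R : ConformalRectangle} {Φ : ℂ ≃ₜ ℂ} (hΦ : IsSquareModel R Φ)
include hΦ

/-- THE UPPER INCLUSION.  For `0 < s ≤ 1/2` there is `g > 0` such that for meshes `δ` and radii `ρ` with
`δ√2 + ρ ≤ g`, on lattice configurations the fattened crude event `upperCrossing R ρ δ` implies that the short fat
chart quad `Ψ([-1+s, 1-s] × [-1-s, 1+s])` (`Ψ` the transposed square model) has a crossing inside the drawn open
edges: the polyline of the open walk lies in `Ψ((-1-s, 1+s)²)` and joins `Ψ({re < -1+s})` to `Ψ({re > 1-s})`, so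
it contains a sub-continuum between the two levels `re ∘ Ψ⁻¹ = ∓(1-s)` (`exists_subcontinuum_between_levels`).
[folklore] -/
theorem exists_upper_gap {s : ℝ} (hs : 0 < s) (hs1 : s ≤ 1 / 2) :
    ∃ g : ℝ, 0 < g ∧ ∀ δ ρ : ℝ, 0 < δ → 0 ≤ ρ → δ * Real.sqrt 2 + ρ ≤ g →
      ∀ ω : BondConfig (Site 2), ω ⊆ (zdGraph 2).edgeSet → ω ∈ upperCrossing R ρ δ →
        ∃ K, (fatQuad (tmodel Φ) s).IsCrossing K ∧ K ⊆ openEdgeUnion (δ * Real.sqrt 2) ω := by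
  rw [fatQuad_eq _ hs (by linarith)]
  set Ψ := tmodel Φ with hΨ
  -- three open sets around the closed domain and the two arcs, and the corresponding gaps
  have hO₁ : IsOpen (Ψ '' (Ioo (-1 - s) (1 + s) ×ℂ Ioo (-1 - s) (1 + s))) :=
    Ψ.isOpenMap _ (isOpen_Ioo.reProdIm isOpen_Ioo)
  have hcl : IsCompact (closure R.carrier) := R.isBounded.isCompact_closure
  have hclO₁ : closure R.carrier ⊆ Ψ '' (Ioo (-1 - s) (1 + s) ×ℂ Ioo (-1 - s) (1 + s)) := by
    rw [← tmodel_image_Icc hΦ]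
    refine image_mono fun z hz => ?_
    rw [Complex.mem_reProdIm, mem_Icc, mem_Icc] at hz
    rw [Complex.mem_reProdIm, mem_Ioo, mem_Ioo]
    exact ⟨⟨by linarith, by linarith⟩, by linarith, by linarith⟩
  obtain ⟨g₁, hg₁, hg₁sub⟩ := hcl.exists_cthickening_subset_open hO₁ hclO₁
  have hO₂ : IsOpen (Ψ '' {z : ℂ | z.re < -1 + s}) :=
    Ψ.isOpenMap _ (isOpen_lt Complex.continuous_re continuous_const)
  have h0O₂ : R.arc 0 ⊆ Ψ '' {z : ℂ | z.re < -1 + s} := by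
    rw [← tmodel_image_left hΦ]
    refine image_mono fun z hz => ?_
    rw [Complex.mem_reProdIm, mem_singleton_iff] at hz
    show z.re < -1 + s
    rw [hz.1]; linarith
  obtain ⟨g₂, hg₂, hg₂sub⟩ := (R.isCompact_arc 0).exists_cthickening_subset_open hO₂ h0O₂
  have hO₃ : IsOpen (Ψ '' {z : ℂ | 1 - s < z.re}) :=
    Ψ.isOpenMap _ (isOpen_lt continuous_const Complex.continuous_re)
  have h2O₃ : R.arc 2 ⊆ Ψ '' {z : ℂ | 1 - s < z.re} := by
    rw [← tmodel_image_right hΦ]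
    refine image_mono fun z hz => ?_
    rw [Complex.mem_reProdIm, mem_singleton_iff] at hz
    show 1 - s < z.re
    rw [hz.1]; linarith
  obtain ⟨g₃, hg₃, hg₃sub⟩ := (R.isCompact_arc 2).exists_cthickening_subset_open hO₃ h2O₃
  refine ⟨min g₁ (min g₂ g₃), lt_min hg₁ (lt_min hg₂ hg₃), ?_⟩
  intro δ ρ hδ hρ hg ω hω hup
  have hg₁' : δ * Real.sqrt 2 + ρ ≤ g₁ := hg.trans (min_le_left _ _)
  have hg₂' : δ * Real.sqrt 2 + ρ ≤ g₂ := hg.trans ((min_le_right _ _).trans (min_le_left _ _))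
  have hg₃' : δ * Real.sqrt 2 + ρ ≤ g₃ := hg.trans ((min_le_right _ _).trans (min_le_right _ _))
  set m := δ * Real.sqrt 2 with hm
  have hmpos : 0 < m := by positivity
  have hpt : ∀ x : Site 2, (δ : ℂ) * squareLatticeEmbedding.z x = meshPoint m x := smul_z_eq_meshPoint δ
  obtain ⟨a, ha, b, hb, hab⟩ := hup
  simp only [mem_setOf_eq, hpt] at ha hb
  obtain ⟨W, hWs, hWe⟩ := Literature.Probability.Percolation.exists_walk_of_mem_openConnIn hω hab
  simp only [mem_setOf_eq, hpt] at hWs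
  -- level function and the levels of the two ends
  set φ : ℂ → ℝ := fun z => (Ψ.symm z).re with hφ
  have hφc : Continuous φ := Complex.continuous_re.comp Ψ.symm.continuous
  have hφa : φ (meshPoint m a) ≤ -1 + s := by
    have : meshPoint m a ∈ Ψ '' {z : ℂ | z.re < -1 + s} :=
      hg₂sub (mem_cthickening_of_infDist_le (R.isCompact_arc 0) ⟨_, R.pt_mem_arc_self 0⟩ (ha.trans (by linarith)))
    rw [mem_image_iff_symm_mem] at this
    exact le_of_lt this
  have hφb : 1 - s ≤ φ (meshPoint m b) := by
    have : meshPoint m b ∈ Ψ '' {z : ℂ | 1 - s < z.re} :=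
      hg₃sub (mem_cthickening_of_infDist_le (R.isCompact_arc 2) ⟨_, R.pt_mem_arc_self 2⟩ (hb.trans (by linarith)))
    rw [mem_image_iff_symm_mem] at this
    exact le_of_lt this
  -- the walk is not trivial
  have hnil : ¬ W.Nil := by
    intro hn
    have := hn.eq
    subst this
    linarith
  -- the trace of the walk
  set K₀ : Set ℂ := range (W.toCurve (meshPoint m)) with hK₀
  have hK₀c : IsCompact K₀ := isCompact_range (W.toCurve (meshPoint m)).continuous
  have hK₀conn : IsPreconnected K₀ := isPreconnected_range (W.toCurve (meshPoint m)).continuous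
  have haK₀ : meshPoint m a ∈ K₀ := ⟨0, SimpleGraph.Walk.toCurve_apply_zero _ _⟩
  have hbK₀ : meshPoint m b ∈ K₀ := ⟨1, Literature.Probability.Percolation.toCurve_one _ _⟩
  have hK₀darts := Literature.Probability.Percolation.range_toCurve_subset_iUnion (meshPoint m) hnil
  have hK₀O : K₀ ⊆ openEdgeUnion m ω := by
    intro z hz
    have hz' := hK₀darts hz
    simp only [mem_iUnion] at hz'
    obtain ⟨d, hd, hzd⟩ := hz'
    exact mem_openEdgeUnion_iff.2 ⟨d.fst, d.snd, d.adj, hWe _ (List.mem_map.2 ⟨d, hd, rfl⟩), hzd⟩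
  have hK₀near : ∀ z ∈ K₀, infDist z (closure R.carrier) ≤ m + ρ := by
    intro z hz
    have hz' := hK₀darts hz
    simp only [mem_iUnion] at hz'
    obtain ⟨d, hd, hzd⟩ := hz'
    have h1 : dist (meshPoint m d.fst) z ≤ m :=
      Literature.Probability.Percolation.dist_meshPoint_le_of_mem_segment hmpos d.adj hzd
    have h2 : infDist (meshPoint m d.fst) R.carrier ≤ ρ := hWs _ (W.dart_fst_mem_support_of_mem_darts hd)
    rw [infDist_closure]
    calc infDist z R.carrier ≤ infDist (meshPoint m d.fst) R.carrier + dist z (meshPoint m d.fst) :=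
          infDist_le_infDist_add_dist
      _ ≤ ρ + m := by rw [dist_comm]; exact add_le_add h2 h1
      _ = m + ρ := add_comm _ _
  have hK₀O₁ : K₀ ⊆ Ψ '' (Ioo (-1 - s) (1 + s) ×ℂ Ioo (-1 - s) (1 + s)) := fun z hz =>
    hg₁sub (mem_cthickening_of_infDist_le hcl R.nonempty.closure ((hK₀near z hz).trans hg₁'))
  -- the sub-continuum between the two levels
  obtain ⟨K, hKK₀, hKc, hKconn, hKlev, ⟨z₀, hz₀, hz₀φ⟩, ⟨z₁, hz₁, hz₁φ⟩⟩ :=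
    Literature.Probability.Percolation.exists_subcontinuum_between_levels hφc (by linarith : -1 + s ≤ 1 - s)
      hK₀c hK₀conn ⟨_, haK₀, hφa⟩ ⟨_, hbK₀, hφb⟩
  refine ⟨K, ⟨hKc, ⟨⟨z₀, hz₀⟩, hKconn⟩, ?_, ?_, ?_⟩, hKK₀.trans hK₀O⟩
  · -- inside the carrier
    intro z hz
    rw [carrier_chartQuad, mem_image_iff_symm_mem, Complex.mem_reProdIm, mem_Icc, mem_Icc]
    have h1 := hK₀O₁ (hKK₀ hz)
    rw [mem_image_iff_symm_mem, Complex.mem_reProdIm, mem_Ioo, mem_Ioo] at h1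
    exact ⟨hKlev z hz, h1.2.1.le, h1.2.2.le⟩
  · refine ⟨z₀, hz₀, ?_⟩
    rw [side_zero_chartQuad, mem_image_iff_symm_mem, Complex.mem_reProdIm, mem_singleton_iff, mem_Icc]
    have h1 := hK₀O₁ (hKK₀ hz₀)
    rw [mem_image_iff_symm_mem, Complex.mem_reProdIm, mem_Ioo, mem_Ioo] at h1
    exact ⟨hz₀φ, h1.2.1.le, h1.2.2.le⟩
  · refine ⟨z₁, hz₁, ?_⟩
    rw [side_two_chartQuad, mem_image_iff_symm_mem, Complex.mem_reProdIm, mem_singleton_iff, mem_Icc]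
    have h1 := hK₀O₁ (hKK₀ hz₁)
    rw [mem_image_iff_symm_mem, Complex.mem_reProdIm, mem_Ioo, mem_Ioo] at h1
    exact ⟨hz₁φ, h1.2.1.le, h1.2.2.le⟩

end Upper

end Freeze

/-- ANCHOR (registered sub-goal). THE UPPER INCLUSION OF THE BRIDGE: for a square model `Φ` of `R` and `0 < s ≤ 1/2`
there is `g > 0` such that for meshes `δ` and fattening radii `ρ` with `δ√2 + ρ ≤ g`, on lattice configurations, the
fattened crude event `Freeze.upperCrossing R ρ δ` implies that the short fat chart quad
`Freeze.fatQuad (Freeze.tmodel Φ) s` has a Schramm–Smirnov crossing inside the drawn open edges of mesh `δ√2`.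
[folklore] -/
theorem upperCrossing_subset_fatQuad_crossing : ∀ (R : ConformalRectangle) (Φ : ℂ ≃ₜ ℂ), Literature.Probability.Percolation.IsSquareModel R Φ → ∀ (s : ℝ), 0 < s → s ≤ 1 / 2 → ∃ g : ℝ, 0 < g ∧ ∀ (δ ρ : ℝ), 0 < δ → 0 ≤ ρ → δ * Real.sqrt 2 + ρ ≤ g → ∀ (ω : Literature.Probability.Percolation.BondConfig (Literature.Probability.LatticeModels.Site 2)), ω ⊆ (Literature.Probability.LatticeModels.zdGraph 2).edgeSet → ω ∈ Freeze.upperCrossing R ρ δ → ∃ K : Set ℂ, (Freeze.fatQuad (Freeze.tmodel Φ) s).IsCrossing K ∧ K ⊆ Literature.Probability.Percolation.openEdgeUnion (δ * Real.sqrt 2) ω :=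
  fun _ _ hΦ _ hs hs1 => Freeze.exists_upper_gap hΦ hs hs1

end Summit.CriticalPhenomena.CardyFormulaZ2.Theorems.CornerLineDescent.SymmetricSeed
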